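import Literature.Computability.QuantumComplexity.BQP
import Literature.Computability.QuantumComplexity.SimUniformity
import HarnessLib

/-!
# `BQP = BPP` (quantum-advantage.S02) is exactly the negation of the summit form

Sibling proof file of `QuantumComplexity/BQP.lean` for the named statement
`BQPEqBPP : Prop := BQP = BPP` (quantum-advantage.S02, the "negation summit").

**Status of `BQPEqBPP`.** It is an OPEN PROBLEM, not a result in print, so it has no discharge
`BQPEqBPP_holds` (D-0014 discharges are for published theorems): Arora–Barak 2009, §10.7,
pp. 209–210 ("What is the relation between BQP and the classes we already encountered such as P,
BPP and NP? This is very much an open question"; "Does BQP = BPP? The main reason to believe this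
is false is the polynomial-time quantum algorithm for integer factorization …"); Nielsen–Chuang
2010, §1.4.5, pp. 41–42 ("Exactly where BQP fits with respect to P, NP and PSPACE is as yet
unknown"); Aaronson 2010, §1 ("It is now widely conjectured that BPP ≠ BQP"). Its negation, in the
existential form `∃ L, L ∈ BQP ∧ L ∉ BPP`, is the summit `QuantumAdvantage`
(`Summits/QuantumAdvantage/QuantumAdvantage/Statement.lean`, not importable from `Literature/`),
and the class equality itself is the target of the summit-side route `Dequantize`.

**Proved here** (set theory plus the *discharged* inclusion `BPP ⊆ BQP`,
`BPP_subset_BQP_holds` of `SimUniformity.lean`; Bernstein–Vazirani 1997, Thm. 8.3):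

* `BQPEqBPP.subset : BQPEqBPP → BQP ⊆ BPP` and
  `BQPEqBPP.not_exists : BQPEqBPP → ¬ ∃ L, L ∈ BQP ∧ L ∉ BPP` (unconditional directions);
* `bqpEqBPP_iff_subset : BQPEqBPP ↔ BQP ⊆ BPP` (the shape of the `Dequantize` thesis);
* `bqpEqBPP_iff_not_exists : BQPEqBPP ↔ ¬ ∃ L : Language Bool, L ∈ BQP ∧ L ∉ BPP` and
  `not_bqpEqBPP_iff_exists : ¬ BQPEqBPP ↔ ∃ L : Language Bool, L ∈ BQP ∧ L ∉ BPP` — S02 is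
  *literally* `¬ QuantumAdvantage` and `BQP ≠ BPP` is literally `QuantumAdvantage` (same terms).

Consequently a proof of `BQPEqBPP` would settle the summit `QuantumAdvantage` negatively, and a
proof of its negation would settle it positively; neither exists in the literature.

## References

* S. Arora, B. Barak, *Computational Complexity: A Modern Approach*, CUP 2009, §10.7 (`BQP` and
  classical classes; "Does BQP = BPP?"), Cor. 10.11 (`BPP ⊆ BQP`). [AroraBarak2009]
* M. A. Nielsen, I. L. Chuang, *Quantum Computation and Quantum Information*, CUP 2010, §1.4.5.
* E. Bernstein, U. Vazirani, *Quantum complexity theory*, SIAM J. Comput. 26 (1997) 1411–1473,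
  Thm. 8.3 (`BPP ⊆ BQP`). [BernsteinVazirani1997]
* S. Aaronson, *BQP and the polynomial hierarchy*, STOC 2010, §1. [Aaronson2010]
-/

namespace Literature.Computability.QuantumComplexity

open Literature.Computability.Complexity Literature.Computability.Cryptography

/-- `BQP = BPP` gives `BQP ⊆ BPP` (unconditional direction). [folklore] -/
theorem BQPEqBPP.subset (h : BQPEqBPP) : BQP ⊆ BPP := by
  unfold BQPEqBPP at h
  exact h.le

/-- `BQP = BPP` leaves no language in `BQP ∖ BPP`: the negation summit S02 refutes the
existential summit form `∃ L, L ∈ BQP ∧ L ∉ BPP` (unconditional direction, pure set theory).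
[folklore] -/
theorem BQPEqBPP.not_exists (h : BQPEqBPP) : ¬ ∃ L : Language Bool, L ∈ BQP ∧ L ∉ BPP := by
  rintro ⟨L, hL, hL'⟩
  exact hL' (h.subset hL)

/-- `BQP = BPP ↔ BQP ⊆ BPP`, by antisymmetry with the theorem `BPP ⊆ BQP`
(`BPP_subset_BQP_holds`; Bernstein–Vazirani 1997, Thm. 8.3; Arora–Barak 2009, Cor. 10.11).
This is the shape of the summit-side thesis "every `BQP` language is in `BPP`".
[cite: BernsteinVazirani1997, Thm. 8.3] -/
theorem bqpEqBPP_iff_subset : BQPEqBPP ↔ BQP ⊆ BPP :=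
  ⟨BQPEqBPP.subset, fun h => Set.Subset.antisymm h BPP_subset_BQP_holds⟩

/-- **S02 is exactly the negation of the summit form.** `BQP = BPP ↔ ¬ ∃ L, L ∈ BQP ∧ L ∉ BPP`
(the right-hand side is verbatim `¬ Literature.QuantumAdvantage.BQPNotSubsetBPP`, i.e.
`¬ QuantumAdvantage`), using `BPP ⊆ BQP` (Bernstein–Vazirani 1997, Thm. 8.3) for `←`. Both sides
are open problems (Arora–Barak 2009, §10.7; Nielsen–Chuang 2010, §1.4.5).
[cite: BernsteinVazirani1997, Thm. 8.3] -/
theorem bqpEqBPP_iff_not_exists :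
    BQPEqBPP ↔ ¬ ∃ L : Language Bool, L ∈ BQP ∧ L ∉ BPP := by
  refine ⟨BQPEqBPP.not_exists, fun h => bqpEqBPP_iff_subset.2 fun L hL => ?_⟩
  by_contra hL'
  exact h ⟨L, hL, hL'⟩

/-- `BQP ≠ BPP ↔ ∃ L, L ∈ BQP ∧ L ∉ BPP`: the class inequality (quantum-advantage.S01 of the
inventory) is equivalent to the existential summit form `QuantumAdvantage` (verbatim right-hand
side), given `BPP ⊆ BQP` (Bernstein–Vazirani 1997, Thm. 8.3); cf. Aaronson 2010, §1 ("widely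
conjectured that BPP ≠ BQP"). [cite: BernsteinVazirani1997, Thm. 8.3] -/
theorem not_bqpEqBPP_iff_exists :
    ¬ BQPEqBPP ↔ ∃ L : Language Bool, L ∈ BQP ∧ L ∉ BPP := by
  rw [bqpEqBPP_iff_not_exists, not_not]

end Literature.Computability.QuantumComplexity
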